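import Summits.BirchSwinnertonDyer.Rank1Residual.Additive.KobayashiSignedGenerationTower
import Literature.NumberTheory.EllipticCurves.EichlerShimuraCongruenceHondaProofs
import HarnessLib

/-!
# The `ℤ_p`-model of a globally minimal curve at a good SUPERSINGULAR prime `p ∣ a_p` (any `a_p`, not only `a_p = 0`):
# elliptic fibres, `tr(M mod p) = a_p`, unit discriminant, Hasse coefficient in `pℤ_p`, and `‖a_p‖_p ≤ p⁻¹`
# (route `PrintX8VS` / `PrintX8`, support item `InputHondaSystem` = stmt-BirchSwinnertonDyer-20413, named fact
# `Sprung2012.thm22_exists_isHondaSystem`; file 6 of the local series — the `p ∣ a_p` twin of the tree's `a_p = 0` lemmas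
# `exists_padicModel_tr_eq_zero` / `exists_goodSupersingularPadicModel` / `hasseCoeff_mem_maximalIdeal_of_tr_eq_zero`)

HONEST FRAMING (desk `pub/bsd-wall/bsd-inputs`, seat `bsd-inputs-honda-p1`, D-0154 (2) INPUTS): THEOREMS ONLY — no definition, no
named fact, no instance, no `sorry`; closes nothing by itself; BSD is not proved by any of this.

* `hasseCoeff_mem_maximalIdeal_of_dvd_tr` — for `M/ℤ_p` with `M mod p` elliptic (`p` odd) and `p ∣ tr(M mod p)`:
  `A_p(M) ∈ pℤ_p` (the Hasse coefficient reduces to `tr` in `𝔽_p`, tree `cast_card_add_one_sub_natCard_point`, Silverman V.4.1(a)).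
* **`exists_padicModel_of_dvd_frobeniusTrace`** — for `V/ℚ` elliptic, globally minimal, good at the odd prime `p` with `p ∣ a_p(V)`
  there is `M/ℤ_p` (the integral model read in `ℤ_p`) with: `M ⊗ ℚ_p` and `M mod p` elliptic, `tr(M mod p) = a_p(V)`, `Δ(M) ∈ ℤ_pˣ`,
  `A_p(M) ∈ pℤ_p`, and `M ⊗ ℚ̄_p = V ⊗ ℚ̄_p` — the binders of the tree's Kobayashi/Honda local series (`hE`, `hEt`, `htr`-type,
  `hΔ`, `hA`, `hWM`) for a supersingular prime with arbitrary `a_p` (Sprung 2012 §2: "we make no special assumption on `a_p`").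
* `norm_intCast_frobeniusTrace_le` — `‖a_p‖_p ≤ p⁻¹` (the growth hypothesis of the Sprung sequence, file 1).

References: [Sprung2012] F. Sprung, J. Number Theory 132 (2012), §2 (p. 1486–1487); [Kobayashi2003] S. Kobayashi, Invent. Math. 152
(2003), §8.2–8.4; [SilvermanAEC2009] J. H. Silverman, AEC, V.4.1(a), VII.2.
-/

set_option autoImplicit false
-- the Theorems namespace of this sub repeats the summit name by design (D-0017 nested layout)
set_option linter.dupNamespace false

noncomputable section

open scoped Classical

namespace Summit.BirchSwinnertonDyer.BirchSwinnertonDyer.Theorems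

namespace SprungHonda

open WeierstrassCurve Literature.NumberTheory.EllipticCurves Summit.BirchSwinnertonDyer.Rank1Residual.Additive

variable {p : ℕ} [hp : Fact p.Prime]

/-- **`A_p(M) ∈ pℤ_p` when `p ∣ tr(M mod p)`** (`p` odd): the Hasse coefficient of `M mod p` is the image of `tr` in `𝔽_p`.
[cite: SilvermanAEC2009, Thm. V.4.1(a)] -/
theorem hasseCoeff_mem_maximalIdeal_of_dvd_tr (hp2 : p ≠ 2) (M : WeierstrassCurve ℤ_[p]) [(M.map PadicInt.toZMod).IsElliptic]
    (htr : (p : ℤ) ∣ Literature.NumberTheory.EllipticCurves.HasseManin.tr (M.map PadicInt.toZMod)) :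
    M.hasseCoeff p ∈ IsLocalRing.maximalIdeal ℤ_[p] := by
  have h2 : ringChar (ZMod p) ≠ 2 := by rwa [ZMod.ringChar_zmod_n]
  have key := (M.map PadicInt.toZMod).cast_card_add_one_sub_natCard_point h2
  have htr' : ((((Fintype.card (ZMod p) : ℤ) + 1 - Nat.card (M.map PadicInt.toZMod).toAffine.Point : ℤ) : ℤ) : ZMod p) = 0 :=
    (ZMod.intCast_zmod_eq_zero_iff_dvd _ p).mpr htr
  rw [htr', ZMod.card] at key
  have hA : (M.map PadicInt.toZMod).hasseCoeff p = 0 := by rw [hasseCoeff]; exact key.symm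
  rw [map_hasseCoeff] at hA
  rw [← PadicInt.ker_toZMod, RingHom.mem_ker]
  exact hA

/-- **The supersingular `ℤ_p`-model with arbitrary `a_p`.** For `V/ℚ` elliptic, globally minimal, with good reduction at the odd
prime `p` and `p ∣ a_p(V)`: the model `M = integralModelInt V ⊗ ℤ_p` has elliptic generic and special fibres, `tr(M mod p) = a_p(V)`,
unit discriminant, Hasse coefficient in `pℤ_p`, and `M ⊗ ℚ̄_p = V ⊗ ℚ̄_p`. [cite: Sprung2012, §2 (p. 1486)] [cite: SilvermanAEC2009, VII.2] -/
theorem exists_padicModel_of_dvd_frobeniusTrace (hp2 : p ≠ 2) (V : WeierstrassCurve ℚ) [V.IsElliptic] [V.IsGloballyMinimal]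
    (hgood : V.HasGoodReductionAtPrime p) (hap : (p : ℤ) ∣ V.frobeniusTrace p) :
    ∃ M : WeierstrassCurve ℤ_[p], (M.map PadicInt.Coe.ringHom).IsElliptic ∧ (M.map PadicInt.toZMod).IsElliptic ∧
      Literature.NumberTheory.EllipticCurves.HasseManin.tr (M.map PadicInt.toZMod) = V.frobeniusTrace p ∧
      IsUnit M.Δ ∧ M.hasseCoeff p ∈ IsLocalRing.maximalIdeal ℤ_[p] ∧
      M.baseChange (AlgebraicClosure ℚ_[p]) = V.baseChange (AlgebraicClosure ℚ_[p]) := by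
  have hΔ : ¬ (p : ℤ) ∣ minimalDiscriminantInt V :=
    not_dvd_minimalDiscriminantInt_of_hasGoodReductionAtPrime' V p hgood
  set M : WeierstrassCurve ℤ_[p] := (integralModelInt V).map (Int.castRingHom ℤ_[p]) with hM
  have hmodp : M.map PadicInt.toZMod = (integralModelInt V).map (Int.castRingHom (ZMod p)) := by
    rw [hM, WeierstrassCurve.map_map]
    exact congrArg (fun φ : ℤ →+* ZMod p ↦ (integralModelInt V).map φ) (RingHom.ext_int _ _)
  have hgen : M.map PadicInt.Coe.ringHom = (integralModelInt V).map (Int.castRingHom ℚ_[p]) := by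
    rw [hM, WeierstrassCurve.map_map]
    exact congrArg (fun φ : ℤ →+* ℚ_[p] ↦ (integralModelInt V).map φ) (RingHom.ext_int _ _)
  haveI hEt' : ((integralModelInt V).map (Int.castRingHom (ZMod p))).IsElliptic := by
    refine ⟨isUnit_iff_ne_zero.mpr ?_⟩
    rw [map_Δ, eq_intCast]
    change ((minimalDiscriminantInt V : ℤ) : ZMod p) ≠ 0
    rwa [Ne, ZMod.intCast_zmod_eq_zero_iff_dvd]
  haveI hEt : (M.map PadicInt.toZMod).IsElliptic := by rw [hmodp]; infer_instance
  have htr : Literature.NumberTheory.EllipticCurves.HasseManin.tr (M.map PadicInt.toZMod) = V.frobeniusTrace p := by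
    have e : Literature.NumberTheory.EllipticCurves.HasseManin.tr (M.map PadicInt.toZMod) =
        Literature.NumberTheory.EllipticCurves.HasseManin.tr ((integralModelInt V).map (Int.castRingHom (ZMod p))) := by
      rw [hmodp]
    rw [e]
    exact tr_eq_frobeniusTrace V rfl
  refine ⟨M, ?_, hEt, htr, ?_, ?_, ?_⟩
  · rw [hgen]
    refine ⟨isUnit_iff_ne_zero.mpr ?_⟩
    rw [map_Δ, eq_intCast]
    change ((minimalDiscriminantInt V : ℤ) : ℚ_[p]) ≠ 0
    exact_mod_cast minimalDiscriminantInt_ne_zero V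
  · rw [hM, map_Δ, eq_intCast]
    exact Literature.NumberTheory.LFunctions.Wooley.isUnit_intCast_of_not_dvd hΔ
  · exact hasseCoeff_mem_maximalIdeal_of_dvd_tr hp2 M (htr ▸ hap)
  · conv_rhs => rw [← map_integralModelInt V]
    rw [hM, WeierstrassCurve.baseChange, WeierstrassCurve.baseChange, WeierstrassCurve.map_map,
      WeierstrassCurve.map_map]
    congr 1

/-- **`‖a_p‖_p ≤ p⁻¹`** for an integer `a_p` divisible by `p` (the supersingular growth hypothesis of the Sprung sequence, file 1).
[cite: Sprung2012, §2 (p. 1486)] -/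
theorem norm_intCast_le_inv_of_dvd {a : ℤ} (ha : (p : ℤ) ∣ a) : ‖((a : ℤ) : ℚ_[p])‖ ≤ (p : ℝ)⁻¹ := by
  obtain ⟨b, rfl⟩ := ha
  rw [Int.cast_mul, Int.cast_natCast, norm_mul, Padic.norm_p]
  calc (p : ℝ)⁻¹ * ‖(b : ℚ_[p])‖ ≤ (p : ℝ)⁻¹ * 1 :=
        mul_le_mul_of_nonneg_left (Padic.norm_int_le_one b) (by positivity)
    _ = (p : ℝ)⁻¹ := mul_one _

/-- For an odd prime `p` and `p ∣ a`: `a ≠ 2` and `a − 2` is a `p`-adic unit (`a − 2 ≡ −2 (mod p)`) — used to read off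
`z(c_{−1})` from `z(c_0) = (a_p − 2)·z(c_{−1})` in the generation clauses. [folklore] -/
theorem intCast_sub_two_isUnit_of_dvd (hp2 : p ≠ 2) {a : ℤ} (ha : (p : ℤ) ∣ a) :
    a - 2 ≠ 0 ∧ IsUnit (((a - 2 : ℤ) : ℤ_[p])) := by
  have hp2' : ¬ (p : ℤ) ∣ 2 := by
    intro h
    have h2 : (p : ℤ) ≤ 2 := Int.le_of_dvd two_pos h
    have := hp.out.two_le
    omega
  have hnd : ¬ (p : ℤ) ∣ a - 2 := by
    intro h
    exact hp2' (by simpa using (Int.dvd_sub h ha).neg_right)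
  refine ⟨fun h0 ↦ hnd (h0 ▸ dvd_zero _), ?_⟩
  rw [PadicInt.isUnit_iff]
  by_contra hne
  have hlt : ‖((a - 2 : ℤ) : ℤ_[p])‖ < 1 := lt_of_le_of_ne (PadicInt.norm_le_one _) hne
  exact hnd ((PadicInt.norm_int_lt_one_iff_dvd _).mp hlt)

end SprungHonda

end Summit.BirchSwinnertonDyer.BirchSwinnertonDyer.Theorems

end
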